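import Literature.NumberTheory.PAdicHodge.BmaxPlusFormalLogDivisionTower
import Literature.NumberTheory.PAdicHodge.BmaxPlusFrobeniusEigenTeichLog
import HarnessLib

/-!
# (K₂) in the φ-road's normalisation: the Legendre resolution `D(u, u′) = Λ·φΛ′ − φΛ·Λ′` maps into `ℚ_p·X⁰_k` modulo `Fil^k`

Topic `Literature/NumberTheory/PAdicHodge`; namespace `Literature.NumberTheory.PAdicHodge.AinfTop`. THEOREMS ONLY (no definition, no named
fact, no instance, no `sorry`). The membership (K₂) of line `kato_lever` (crux K★ `stmt-BirchSwinnertonDyer-22226`; memos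
`Cruxes/StarredOptimalManinUnitFiveSeven/Lines/kato-lever-K3-legendre.md` §5 `KTwoMembership`, `…-K2-phi-road.md` §0, `…-K2-tdiv-g25.md` §4) in the
φ-road's own currency: for `W/ℤ` with `log_W` of Honda type `p − aT + T²` and ANY two `[p]_W`-division sequences `u, u′` of points of `Ŵ(𝔪_{ℂ_F})`
(e.g. `u ∈ T_pŴ` a torsion sequence and `u′` a division sequence of a rational point `P = u′₀`), the Legendre resolution
`D(u,u′) = Λ·φΛ′ − φΛ·Λ′` of the `A_max`-periods is a `φ = p` eigenvector (edix-p4 g25, `frobBmaxPlus_det_logSum_divisionLiftPt`), hence by the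
fundamental-exact-sequence fragment (edix-p1 g25, `isTeichLog_pow_mul_of_bdR_lim_modFil_of_frobBmaxPlus_eq`):

* ★★★ `isTeichLog_pow_mul_of_bdR_lim_modFil_det` — **every comparison limit `L_D ∈ B_dR⁺` of `D(u,u′)` modulo `Fil^k` (`k ≥ 1`) has
  `IsTeichLog k (p^M·L_D)` for some `M`**, i.e. `D(u,u′) ∈ ℚ_p·X⁰_k + Fil^k = ℚ_p ⊗ log[1+𝔪♭] + Fil^k` — Kato's «`x ∈ X ⊗ V`» / Bloch–Kato Ex. 3.11
  for the explicit resolution, here for `ℤ_p`-models with `log_W` of Honda type (good reduction), `B_cris`-free.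

What remains for the socket's `KTwoMembership` (B8b) is the identification of `(Λ, φΛ)` on `T_pŴ` with the Legendre-normalised `(Pω, Pη)` (for `Pω`
see edix-p4's `BmaxPlusFormalLogTatePeriods`: `Λ ↦ p^N·∫ω` mod `Fil^k`) and of `(Λ_P, φΛ_P)` with an integrating pair of the Kummer cocycle of `P`.
Infrastructure only; BSD / K★ are not proved by any of this.

## References
* [Kato1993LNM1553] K. Kato, *Lectures on the approach to Iwasawa theory for Hasse–Weil L-functions via B_dR*, LNM 1553 (1993), Ch. II §1.4.
* [FontaineOuyang2022] J.-M. Fontaine, Y. Ouyang, *Theory of p-adic Galois representations*, §6.1.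
* [Colmez1992PeriodesAbeliennes] P. Colmez, *Périodes p-adiques des variétés abéliennes*, Math. Ann. 292 (1992), §2.
-/

noncomputable section

open Ideal WittVector MvPowerSeries ValuativeRel Field

namespace Literature.NumberTheory.PAdicHodge

namespace AinfTop

open Literature.NumberTheory.GaloisRepresentations Literature.NumberTheory.GaloisRepresentations.IsNonarchimedeanLocalField
open Literature.NumberTheory.GaloisRepresentations.LubinTate Literature.NumberTheory.EllipticCurves
open Literature.RingTheory.FormalGroups Literature.AlgebraicGeometry.Resolution
open GaloisContinuity

variable {F : Type} [Field F] [ValuativeRel F] [TopologicalSpace F] [IsNonarchimedeanLocalField F]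
  [CharZero F] {p : ℕ} [Fact p.Prime] [Fact (¬ IsUnit (p : integerC F))]
  [IsAdicComplete (Ideal.span {(p : integerC F)}) (integerC F)]
  {hθ : Function.Surjective (fontaineTheta (integerC F) p)} (W : WeierstrassCurve ℤ)

set_option maxHeartbeats 1600000 in
/-- ★★★ **(K₂) for the φ-road's Legendre resolution.** For `W/ℤ` with `log_W` of Honda type `p − aT + T²` (`he`), any two `[p]_W`-division sequences
`u, u′` of `Ŵ(𝔪_{ℂ_F})` with `A_max`-periods `Λ = Λ_N(ι[ũ], z)`, `Λ′ = Λ_{N′}(ι[ũ′], z′)`, `k ≥ 1`, and any comparison limit `L_D ∈ B_dR⁺(F)` of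
`D = Λ·φΛ′ − φΛ·Λ′` modulo `Fil^k` (`BmaxPlusBdRModFil.exists_bdR_lim_modFil`): **`IsTeichLog k (p^M·L_D)` for some `M`** — the resolution lies in
`ℚ_p·log[1 + 𝔪♭] + Fil^k`. (`φD = pD` by the exact Dieudonné–Honda relation, then the fundamental-exact-sequence fragment.)
[cite: Kato1993LNM1553, Ch. II §1.4] [cite: FontaineOuyang2022, §6.1] -/
theorem isTeichLog_pow_mul_of_bdR_lim_modFil_det (hpv : valuation F p < 1) (a : ℤ_[p]) (e : ℕ → ℤ_[p])
    (he : ∀ m : ℕ, m ≠ 0 → (m : ℤ_[p]) * e m =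
      GaloisContinuity.formalLogNum W p m - (if p ∣ m then a * GaloisContinuity.formalLogNum W p (m / p) else 0) +
        (if p ^ 2 ∣ m then (p : ℤ_[p]) * GaloisContinuity.formalLogNum W p (m / p ^ 2) else 0))
    {u u' : ℕ → (maxNilIdealC F).toIdeal} (hup : ∀ n, mulPC F p W (u (n + 1)) = u n) (hup' : ∀ n, mulPC F p W (u' (n + 1)) = u' n)
    {N N' : ℕ} (hN : 1 ≤ N) (hN' : 1 ≤ N') {z z' : bmaxZero F p}
    (hz : algebraMap (Ainf (p := p) F) (bmaxZero F p)
        ((AinfTop.of F p).symm (((divisionLiftPt W hθ u hup).val : (nilTheta F p hθ).toIdeal) : AinfTop F p)) ^ N =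
      (p : bmaxZero F p) * z)
    (hz' : algebraMap (Ainf (p := p) F) (bmaxZero F p)
        ((AinfTop.of F p).symm (((divisionLiftPt W hθ u' hup').val : (nilTheta F p hθ).toIdeal) : AinfTop F p)) ^ N' =
      (p : bmaxZero F p) * z')
    {k : ℕ} (hk : 1 ≤ k) {L : BDeRhamPlus (integerC F) p} {r : ℕ}
    (hL : (∀ M₁ M : ℕ, M₁ + r ≤ M → ∀ y : bmaxZero F p,
      AdicCompletion.evalₐ (Ideal.span {(p : bmaxZero F p)}) M
          ((PadicLogSeries.logSum ((algebraMap (Ainf (p := p) F) (bmaxZero F p)).comp zpToAinf) (GaloisContinuity.formalLogNum W p) N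
              (algebraMap (Ainf (p := p) F) (bmaxZero F p)
                ((AinfTop.of F p).symm (((divisionLiftPt W hθ u hup).val : (nilTheta F p hθ).toIdeal) : AinfTop F p))) z) *
            frobBmaxPlus F p (PadicLogSeries.logSum ((algebraMap (Ainf (p := p) F) (bmaxZero F p)).comp zpToAinf) (GaloisContinuity.formalLogNum W p) N'
              (algebraMap (Ainf (p := p) F) (bmaxZero F p)
                ((AinfTop.of F p).symm (((divisionLiftPt W hθ u' hup').val : (nilTheta F p hθ).toIdeal) : AinfTop F p))) z') -
          frobBmaxPlus F p (PadicLogSeries.logSum ((algebraMap (Ainf (p := p) F) (bmaxZero F p)).comp zpToAinf) (GaloisContinuity.formalLogNum W p) N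
              (algebraMap (Ainf (p := p) F) (bmaxZero F p)
                ((AinfTop.of F p).symm (((divisionLiftPt W hθ u hup).val : (nilTheta F p hθ).toIdeal) : AinfTop F p))) z) *
            (PadicLogSeries.logSum ((algebraMap (Ainf (p := p) F) (bmaxZero F p)).comp zpToAinf) (GaloisContinuity.formalLogNum W p) N'
              (algebraMap (Ainf (p := p) F) (bmaxZero F p)
                ((AinfTop.of F p).symm (((divisionLiftPt W hθ u' hup').val : (nilTheta F p hθ).toIdeal) : AinfTop F p))) z')) =
        Ideal.Quotient.mk _ y →
      ∃ (c : Ainf (p := p) F) (w : BDeRhamPlus (integerC F) p),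
        (p : BDeRhamPlus (integerC F) p) ^ k *
            (L - algebraMap (Localization.Away (p : Ainf (p := p) F)) (BDeRhamPlus (integerC F) p)
              (y : Localization.Away (p : Ainf (p := p) F))) =
          ainfToBdR ((p : Ainf (p := p) F) ^ M₁ * c) + xiBdR ^ k * w)) :
    ∃ M : ℕ, IsTeichLog k ((p : BDeRhamPlus (integerC F) p) ^ M * L) :=
  isTeichLog_pow_mul_of_bdR_lim_modFil_of_frobBmaxPlus_eq hθ hpv hk
    (frobBmaxPlus_det_logSum_divisionLiftPt W (hθ := hθ) a e he hup hup' hN hN' hz hz') hL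

end AinfTop

end Literature.NumberTheory.PAdicHodge

end
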